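import Summits.QuantumFields.YangMills.Theorems.UnitScaleTiltProp7BlendedGauge
import Summits.QuantumFields.YangMills.Theorems.UnitScaleTiltProp7AxialGaugeSup
import HarnessLib

/-!
# Route `UnitScaleTilt`, crux K1 child «MinimiserStabilityRegPr» (stmt-QuantumFields-19200), route-R ∕ α-P second line, E′ growth side under
# ★★OWNER RULING g27-№8 «UNTWISTED (U2)» — R2 (c): THE CORNER DATA OF THE W-COMB-TRANSPORTED CENTRE GAUGE AND THE UNTWISTED CHART OF RECORD
# `D‴ = −i·log((X^g)_b·W_b⁻¹)` for a twisted pair `(X, u)` (`X^u ∈ (6)(e) ∩ 𝔅_k(V)`): rows (i) sup, (ii) action, (iii) untwisted membership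

Cell `ym3-torus` ∕ width seat `ym-ust-19200-w1` (gen 11; R2 (c) hand per ★★OWNER RULING g27-№8 (2), recipe of ★p1 g14, bus 2026-08-28 16:22:42Z).  THEOREMS ONLY
(0 `def`, 0 `sorry`); `--supports stmt-QuantumFields-19200`, count-neutral.  YM₃ on T³ is a ladder rung (R3), not the Clay problem; nothing here claims the stub,
the crux, d = 4 or the mass gap; E′ is NOT closed by this file.

WHY.  ✓`Prop7TwistRegauge.exists_untwistedRegauge_T3` (★p1 g14) re-gauges a twisted representative `X` (`X^u ∈ (6)(e) ∩ 𝔅_k(V)`) onto the untwisted fibre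
by gen 9's prescribed-centre blend, GIVEN corner gauges `vE x y ∈ SU(2)` with `vE (embIter y) y = u (embIter y)` and the cell data (`hvv`: the eight corner gauges of a
cell pairwise `D`-close at `z` and `z + e_μ`; `htr`: `‖vE z y·X_b·vE (z+e_μ) y*·U₀,b* − 1‖ ≤ ρ`).  This file supplies that data for THE W-COMB TRANSPORT OF THE
CENTRE VALUES, `vE x y := W(Γ_{c_y,x})⁻¹·u(c_y)·W(Γ_{c_y,x})` (`c_y = embIter y`, `Γ` the comb of [Balaban1985Averaging] p. 24), at the base `U₀ := W`:
 * `htr` by the COMMUTATOR IDENTITY `vE z·X_b·vE (z+e_μ)⁻¹·W_b⁻¹ = Ad_{W(Γ)⁻¹}((u·Ỹ·u⁻¹)·(u·P_b·u⁻¹·P_b⁻¹))`, `Ỹ = Ad_{W(Γ)}(X_bW_b⁻¹)`, `P_b = W(Γ_{c,z})W_bW(Γ_{c,z+e_μ})⁻¹`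
   the comb-loop holonomy (`≤ 3e·L^{−(K−n)}` by ✓`Prop7AxialGaugeSup.dist1_holAt_combLoop_le`), and `dist1(uPu⁻¹P⁻¹) ≤ 2·dist1 P` — NO smallness of `u` needed;
 * `hvv` from the FIBRE: `X^u, W ∈ 𝔅_k(V)` ⇒ `u(c_y)·X̄(c)·u(c_{y′})⁻¹ = W̄(c)` on coarse bonds (`X̄, W̄` the `(K−n)`-fold (0.4)-averages; ✓`iter_gaugeAct` +
   ✓`iter_eq_of_mem_fibre`), whence `dist1(vE z y·vE z y′⁻¹) ≤ 2·dist1(W̄(c)·T⁻¹) + dist1(X̄(c)W̄(c)⁻¹)`, `T = W(Γ_{c_y,z})W(Γ_{c_{y′},z})⁻¹`, with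
   `dist1(W̄(c)T⁻¹) ≤ (449∕4)e` (✓`Prop7BlendCells.dist1_iter_mul_inv_cornerWord_le_T3`) and the coarse twist `dist1(X̄(c)W̄(c)⁻¹) ≤ τ` DISPLAYED (`≤ 2σ` from a sup
   `dist1(u x) ≤ σ`, §3).
Then (sibling file `…Prop7UntwistChartOfTwist`) ✓`exists_untwistedRegauge_T3` + ✓`Prop7UntwistedChartOfBlend.expHerm_hermLog` give the untwisted chart `D‴` with rows
(i)(ii)(iii) of the final door ✓`Prop7LocMinOfChartSliceHess.stub_PV3E_of_chartSliceHess` — ★p1 g14's representative of record for rows (ii)(iii).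

WHAT IS PROVED (ns `…Theorems.Prop7UntwistCornerData`).  §1 group algebra: `dist1_comm_le`, `dist1_cornerTransport_le`, `dist1_cornerPair_le`, `dist1_chain3_le`;
§2 at the carrier: `dist1_combLoop_corner_le_T3`, `iter_gaugeAct_centre_eq_of_mem`, ★ `dist1_vE_adj_le_T3`, ★ `dist1_vE_pair_le_T3`, ★ `dist1_vE_transport_le_T3`.
The assembly (cell data ⇒ ✓`exists_untwistedRegauge_T3` ⇒ the untwisted chart `D‴` with rows (i)(ii)(iii)) is the sibling file `…Prop7UntwistChartOfTwist`.

HONEST SCOPE.  Bookkeeping over gen 9's comb∕cell letters; the coarse twist bound `τ` and the fibre identity are displayed hypotheses here (the sibling file derives the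
identity from membership and `τ ≤ 2σ` from a sup on `u`); rows (iv)∕(v) of the E′ door are not touched.

References: T. Bałaban, CMP 102 (1985) 277–309 [Balaban1985Variational] ((4)–(6) p.278, (15) p.280, (18) p.280, (112) p.294); CMP 99 (1985) 75–102
[Balaban1985RegularSpaces] ((1.19) p.79, Lemma 1 (1.25) p.79, (1.29)–(1.30) p.81); CMP 98 (1985) 17–51 [Balaban1985Averaging] ((8)–(13) pp.18–19, pp.24–25).
-/

noncomputable section

open NormedSpace
open scoped Matrix.Norms.L2Operator

namespace Summit.QuantumFields.YangMills.Theorems.Prop7UntwistCornerData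

open Literature.MathematicalPhysics.QuantumFieldTheory.Balaban1983to89
open T4Continuum BlockAveraging
open B10Eq27TorusAxialLog (holT axialT transl transl_apply rel rel_apply contourT holT_eq_holAt contourT_eq holT_contourT axialT_self)
open B7Prop1Explicit (treeWord revWord l1 e e_apply)
open B7Prop1Explicit renaming Site → LSite
open B5Eq118OneStroke (iterBlockOf)
open B15DeterminingSets (embIter)
open Literature.MathematicalPhysics.QuantumFieldTheory.Balaban1983to89.T3ContinuumYM3Torus
open Literature.MathematicalPhysics.QuantumFieldTheory.Balaban1983to89.T3UnitLawDensityEML (ℰp)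
open Literature.MathematicalPhysics.QuantumFieldTheory.Balaban1983to89.T3ConstrainedMinimiser (fibre)
open Literature.MathematicalPhysics.QuantumFieldTheory.Balaban1983to89.T3RegularMinimiser (regThreshold)
open Literature.MathematicalPhysics.QuantumFieldTheory.Balaban1983to89.T3PrintedRegularMinimiser (RegPr RegPr.plaqSmall regFibrePr mem_regFibrePr_iff)
open Literature.MathematicalPhysics.QuantumFieldTheory.Balaban1983to89.T3SectALandauChart (emb15 pos_of_regPr)
open BlockAveragingEMLLinearisedBackground (pertVar pertVar_eq)
open Summit.QuantumFields.YangMills.Theorems.Prop7FlatHolonomy (transfUp_eq_embIter)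
open Summit.QuantumFields.YangMills.Theorems.Prop7AxialGaugeFace (exists_off_embIter)
open Summit.QuantumFields.YangMills.Theorems.Prop7AxialLemma1 (iter_eq_of_mem_fibre)
open Summit.QuantumFields.YangMills.Theorems.Prop7AxialGaugeSup (dist1_holAt_combLoop_le revWord_eq_wordRev)
open Summit.QuantumFields.YangMills.Theorems.Prop7BlendCells
open Summit.QuantumFields.YangMills.Theorems.Prop7BlendCorners
open Summit.QuantumFields.YangMills.Theorems.Prop7BlendSite (coe_inv_SU dist1_mul_inv_eq dist1_transport_eq vec_mem01)
open Summit.QuantumFields.YangMills.Theorems.Prop7BlendedGauge (three_le_sitesPerDir)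

/-! ## §1 Group algebra: the commutator identity of the transported centre gauge -/

section Algebra

variable {G : Type*} [GaugeGroup G]

/-- `dist1(u·P·u⁻¹·P⁻¹) ≤ 2·dist1(P)` — no smallness of `u`. [cite: Balaban1985Averaging, (19)-(21) p.21] -/
theorem dist1_comm_le (u P : G) : dist1 (u * P * u⁻¹ * P⁻¹) ≤ 2 * dist1 P := by
  calc dist1 (u * P * u⁻¹ * P⁻¹) ≤ dist1 (u * P * u⁻¹) + dist1 P⁻¹ := GaugeGroup.dist1_mul_le _ _
    _ = dist1 P + dist1 P := by rw [GaugeGroup.dist1_conj, GaugeGroup.dist1_inv]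
    _ = 2 * dist1 P := by ring

/-- **THE COMMUTATOR IDENTITY OF THE TRANSPORTED CENTRE GAUGE, AS A BOUND**: for `vE(x) = A_x⁻¹·u·A_x` (`A_x` the transporter to `x`),
`dist1(vE(z)·X_b·vE(z′)⁻¹·W_b⁻¹) ≤ dist1(X_b·W_b⁻¹) + 2·dist1(A_z·W_b·A_{z′}⁻¹)`. [cite: Balaban1985RegularSpaces, Lemma 1 (1.25) p.79; Balaban1985Averaging, pp.24-25] -/
theorem dist1_cornerTransport_le (A B u X W : G) :
    dist1 ((A⁻¹ * u * A) * X * (B⁻¹ * u * B)⁻¹ * W⁻¹) ≤ dist1 (X * W⁻¹) + 2 * dist1 (A * W * B⁻¹) := by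
  have hid : (A⁻¹ * u * A) * X * (B⁻¹ * u * B)⁻¹ * W⁻¹ =
      A⁻¹ * ((u * (A * (X * W⁻¹) * A⁻¹) * u⁻¹) * (u * (A * W * B⁻¹) * u⁻¹ * (A * W * B⁻¹)⁻¹)) * A⁻¹⁻¹ := by group
  rw [hid, GaugeGroup.dist1_conj]
  calc dist1 ((u * (A * (X * W⁻¹) * A⁻¹) * u⁻¹) * (u * (A * W * B⁻¹) * u⁻¹ * (A * W * B⁻¹)⁻¹))
      ≤ dist1 (u * (A * (X * W⁻¹) * A⁻¹) * u⁻¹) + dist1 (u * (A * W * B⁻¹) * u⁻¹ * (A * W * B⁻¹)⁻¹) := GaugeGroup.dist1_mul_le _ _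
    _ ≤ dist1 (X * W⁻¹) + 2 * dist1 (A * W * B⁻¹) := by
        rw [GaugeGroup.dist1_conj, GaugeGroup.dist1_conj]; exact add_le_add_right (dist1_comm_le u (A * W * B⁻¹)) _

/-- **ADJACENT CORNER GAUGES AGREE UP TO THE TWIST**: if `u·X̄·u′⁻¹ = W̄` (the coarse bond of the fibre identity), then
`dist1((A⁻¹uA)·(A′⁻¹u′A′)⁻¹) ≤ 2·dist1(W̄·(A·A′⁻¹)⁻¹) + dist1(X̄·W̄⁻¹)`. [cite: Balaban1985RegularSpaces, (1.29)-(1.30) p.81; Balaban1985Averaging, (11)-(13) p.19] -/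
theorem dist1_cornerPair_le (A A' u u' Xb Wb : G) (htw : u * Xb * u'⁻¹ = Wb) :
    dist1 ((A⁻¹ * u * A) * (A'⁻¹ * u' * A')⁻¹) ≤ 2 * dist1 (Wb * (A * A'⁻¹)⁻¹) + dist1 (Xb * Wb⁻¹) := by
  have hu : u = Wb * u' * Xb⁻¹ := by rw [← htw]; group
  have hid : (A⁻¹ * u * A) * (A'⁻¹ * u' * A')⁻¹ =
      A⁻¹ * ((Wb * (A * A'⁻¹)⁻¹) * ((A * A'⁻¹ * u') * (Xb⁻¹ * (A * A'⁻¹)) * (A * A'⁻¹ * u')⁻¹)) * A⁻¹⁻¹ := by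
    rw [hu]; group
  rw [hid, GaugeGroup.dist1_conj]
  have h2 : dist1 (Xb⁻¹ * (A * A'⁻¹)) ≤ dist1 (Xb * Wb⁻¹) + dist1 (Wb * (A * A'⁻¹)⁻¹) := by
    have e0 : Xb⁻¹ * (A * A'⁻¹) = (Xb⁻¹ * Wb) * (Wb⁻¹ * (A * A'⁻¹)) := by group
    have e1 : Xb⁻¹ * Wb = Wb⁻¹ * (Xb * Wb⁻¹)⁻¹ * Wb⁻¹⁻¹ := by group
    have e2 : Wb⁻¹ * (A * A'⁻¹) = (A * A'⁻¹)⁻¹ * (Wb * (A * A'⁻¹)⁻¹)⁻¹ * (A * A'⁻¹)⁻¹⁻¹ := by group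
    have d1 : dist1 (Xb⁻¹ * Wb) = dist1 (Xb * Wb⁻¹) := by rw [e1, GaugeGroup.dist1_conj, GaugeGroup.dist1_inv]
    have d2 : dist1 (Wb⁻¹ * (A * A'⁻¹)) = dist1 (Wb * (A * A'⁻¹)⁻¹) := by rw [e2, GaugeGroup.dist1_conj, GaugeGroup.dist1_inv]
    rw [e0]
    exact (GaugeGroup.dist1_mul_le _ _).trans (by rw [d1, d2])
  calc dist1 ((Wb * (A * A'⁻¹)⁻¹) * ((A * A'⁻¹ * u') * (Xb⁻¹ * (A * A'⁻¹)) * (A * A'⁻¹ * u')⁻¹))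
      ≤ dist1 (Wb * (A * A'⁻¹)⁻¹) + dist1 ((A * A'⁻¹ * u') * (Xb⁻¹ * (A * A'⁻¹)) * (A * A'⁻¹ * u')⁻¹) := GaugeGroup.dist1_mul_le _ _
    _ = dist1 (Wb * (A * A'⁻¹)⁻¹) + dist1 (Xb⁻¹ * (A * A'⁻¹)) := by rw [GaugeGroup.dist1_conj]
    _ ≤ 2 * dist1 (Wb * (A * A'⁻¹)⁻¹) + dist1 (Xb * Wb⁻¹) := by linarith

/-- **CHAINING ADJACENT CORNERS (d = 3)**: a family `f` on `{0,1}³` whose values at corners differing in ONE coordinate are `a`-close is pairwise `3a`-close.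
[cite: Balaban1985RegularSpaces, Lemma 1 (1.25)-(1.26) p.79] -/
theorem dist1_chain3_le {P : Params} (κ0 κ1 κ2 : Fin P.d) (hκ : ∀ ν : Fin P.d, ν = κ0 ∨ ν = κ1 ∨ ν = κ2) (f : LSite P.d → G) {a : ℝ} (ha : 0 ≤ a)
    (hadj : ∀ ε : LSite P.d, (∀ ν, ε ν = 0 ∨ ε ν = 1) → ∀ κ, ε κ = 0 → dist1 (f ε * (f (Function.update ε κ 1))⁻¹) ≤ a)
    (ε ε' : LSite P.d) (hε : ∀ ν, ε ν = 0 ∨ ε ν = 1) (hε' : ∀ ν, ε' ν = 0 ∨ ε' ν = 1) :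
    dist1 (f ε * (f ε')⁻¹) ≤ 3 * a := by
  -- one coordinate: `dist1(f ε · f ε[κ ↦ b]⁻¹) ≤ a` for `b ∈ {0,1}`
  have step : ∀ (ε : LSite P.d), (∀ ν, ε ν = 0 ∨ ε ν = 1) → ∀ (κ : Fin P.d) (b : ℤ), (b = 0 ∨ b = 1) →
      dist1 (f ε * (f (Function.update ε κ b))⁻¹) ≤ a := by
    intro ε hε κ b hb
    rcases hε κ with h0 | h1
    · rcases hb with hb0 | hb1
      · subst hb0
        have : Function.update ε κ 0 = ε := by
          funext ν; by_cases hν : ν = κ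
          · subst hν; simp [h0]
          · rw [Function.update_of_ne hν]
        rw [this, mul_inv_cancel, GaugeGroup.dist1_one]; exact ha
      · subst hb1; exact hadj ε hε κ h0
    · rcases hb with hb0 | hb1
      · subst hb0
        set εz : LSite P.d := Function.update ε κ 0 with hεzdef
        have hεzm : ∀ ν, εz ν = 0 ∨ εz ν = 1 := update_mem01 ε hε κ 0 (Or.inl rfl)
        have hback : Function.update εz κ 1 = ε := by
          funext ν; by_cases hν : ν = κ
          · subst hν; simp [hεzdef, h1]
          · rw [Function.update_of_ne hν, hεzdef, Function.update_of_ne hν]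
        have h := hadj εz hεzm κ (by simp [hεzdef])
        rw [hback] at h
        rwa [← GaugeGroup.dist1_inv, mul_inv_rev, inv_inv]
      · subst hb1
        have : Function.update ε κ 1 = ε := by
          funext ν; by_cases hν : ν = κ
          · subst hν; simp [h1]
          · rw [Function.update_of_ne hν]
        rw [this, mul_inv_cancel, GaugeGroup.dist1_one]; exact ha
  set ε₁ : LSite P.d := Function.update ε κ0 (ε' κ0) with hε₁
  set ε₂ : LSite P.d := Function.update ε₁ κ1 (ε' κ1) with hε₂
  set ε₃ : LSite P.d := Function.update ε₂ κ2 (ε' κ2) with hε₃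
  have hε₁m : ∀ ν, ε₁ ν = 0 ∨ ε₁ ν = 1 := update_mem01 ε hε κ0 _ (hε' κ0)
  have hε₂m : ∀ ν, ε₂ ν = 0 ∨ ε₂ ν = 1 := update_mem01 ε₁ hε₁m κ1 _ (hε' κ1)
  have hε₃ε' : ε₃ = ε' := by
    funext ν
    rcases hκ ν with h | h | h <;> rw [h]
    · simp only [hε₃, hε₂, hε₁]
      by_cases h2 : κ0 = κ2
      · rw [h2, Function.update_self]
      · rw [Function.update_of_ne h2]
        by_cases h1' : κ0 = κ1
        · rw [h1', Function.update_self]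
        · rw [Function.update_of_ne h1', Function.update_self]
    · simp only [hε₃, hε₂]
      by_cases h2 : κ1 = κ2
      · rw [h2, Function.update_self]
      · rw [Function.update_of_ne h2, Function.update_self]
    · simp only [hε₃, Function.update_self]
  have s1 : dist1 (f ε * (f ε₁)⁻¹) ≤ a := step ε hε κ0 _ (hε' κ0)
  have s2 : dist1 (f ε₁ * (f ε₂)⁻¹) ≤ a := step ε₁ hε₁m κ1 _ (hε' κ1)
  have s3 : dist1 (f ε₂ * (f ε₃)⁻¹) ≤ a := step ε₂ hε₂m κ2 _ (hε' κ2)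
  rw [hε₃ε'] at s3
  have hsplit : f ε * (f ε')⁻¹ = (f ε * (f ε₁)⁻¹) * ((f ε₁ * (f ε₂)⁻¹) * (f ε₂ * (f ε')⁻¹)) := by group
  rw [hsplit]
  calc dist1 ((f ε * (f ε₁)⁻¹) * ((f ε₁ * (f ε₂)⁻¹) * (f ε₂ * (f ε')⁻¹)))
      ≤ dist1 (f ε * (f ε₁)⁻¹) + dist1 ((f ε₁ * (f ε₂)⁻¹) * (f ε₂ * (f ε')⁻¹)) := GaugeGroup.dist1_mul_le _ _
    _ ≤ dist1 (f ε * (f ε₁)⁻¹) + (dist1 (f ε₁ * (f ε₂)⁻¹) + dist1 (f ε₂ * (f ε')⁻¹)) := by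
        gcongr; exact GaugeGroup.dist1_mul_le _ _
    _ ≤ 3 * a := by linarith

end Algebra

/-! ## §2 At the d = 3 carrier: the comb loop, the fibre identity on coarse bonds, adjacent and arbitrary corners, transport -/

section T3

open Literature.MathematicalPhysics.QuantumFieldTheory.Balaban1983to89.T3ContinuumYM3Torus

variable (F : T3Family) (n K : ℕ)

/-- **THE COMB LOOP THROUGH A BOND OF THE CELL IS `3e·L^{−(K−n)}`-CLOSE TO `1`**: `W ∈ 𝔘_k(e)` (plaquette clause of (2)), at least three blocks per direction,
uniform centre offset `off`; for the cell of `z`, any corner `y_ε`, and the bond `b = ⟨z, μ⟩`: `dist1(W(Γ_{y_ε,z})·W_b·W(Γ_{y_ε,z+e_μ})⁻¹) ≤ 3e·L^{−(K−n)}`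
(`3L^{K−n}` plaquettes of size `e·L^{−2(K−n)}`, ✓`dist1_holAt_combLoop_le`). [cite: Balaban1985Averaging, pp.24-25; Balaban1985RegularSpaces, Lemma 1 (1.25) p.79] -/
theorem dist1_combLoop_corner_le_T3 (hk : K - n ≤ (F.P K).m + (F.P K).K) (hN : 3 ≤ (F.P K).sitesPerDir (K - n)) {off : ℕ}
    (hoff : ∀ (y : Site (F.P K) (K - n)) (μ : Fin (F.P K).d), ((embIter (K - n) y) μ).val = (y μ).val * (F.P K).L ^ (K - n) + off)
    {e : ℝ} (he : 0 ≤ e) (W : GaugeField (F.P K) 0 (Matrix.specialUnitaryGroup (Fin 2) ℂ)) (hW : RegPr F n K e W)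
    (z : Site (F.P K) 0) (ε : LSite (F.P K).d) (hε : ∀ ν, ε ν = 0 ∨ ε ν = 1) (μ : Fin (F.P K).d) :
    dist1 (axialT W (embIter (K - n) (transl (iterBlockOf (K - n) (transl z (fun _ => -(off : ℤ)))) ε)) z * W ⟨z, μ⟩ *
        (axialT W (embIter (K - n) (transl (iterBlockOf (K - n) (transl z (fun _ => -(off : ℤ)))) ε)) (z.shift μ))⁻¹) ≤
      3 * e * (((F.L : ℝ))⁻¹) ^ (K - n) := by
  set y := embIter (K - n) (transl (iterBlockOf (K - n) (transl z (fun _ => -(off : ℤ)))) ε) with hy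
  have hwrap := noWrap_corner hk hN hoff z ε hε μ
  have hδ0 : 0 ≤ regThreshold F n K e := by unfold regThreshold; positivity
  have h1 : axialT W y z * W ⟨z, μ⟩ * (axialT W y (z.shift μ))⁻¹ = holT W y (contourT y ⟨z, μ⟩) := by
    rw [holT_contourT W y ⟨z, μ⟩ hwrap]; rfl
  rw [h1, holT_eq_holAt, contourT_eq, revWord_eq_wordRev]
  have h2 := dist1_holAt_combLoop_le W hδ0 (RegPr.plaqSmall hW) y (rel y z) μ
  refine h2.trans ?_
  have hl : l1 (rel y z) ≤ 3 * F.L ^ (K - n) := l1_rel_corner_le hk hN hoff z ε hε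
  have hl' : (l1 (rel y z) : ℝ) ≤ 3 * (F.L : ℝ) ^ (K - n) := by exact_mod_cast hl
  have hL0 : (0 : ℝ) < (F.L : ℝ) := by exact_mod_cast F.hL.2.le.trans_lt' (by norm_num)
  have hreg : regThreshold F n K e = e * ((F.L : ℝ)⁻¹) ^ (2 * (K - n)) := rfl
  have hpos : 0 ≤ (((F.L : ℝ))⁻¹) ^ (2 * (K - n)) := pow_nonneg (inv_nonneg.mpr hL0.le) _
  have hcollapse : (F.L : ℝ) ^ (K - n) * (((F.L : ℝ))⁻¹) ^ (2 * (K - n)) = (((F.L : ℝ))⁻¹) ^ (K - n) := by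
    rw [two_mul, pow_add, ← mul_assoc, ← mul_pow, mul_inv_cancel₀ hL0.ne', one_pow, one_mul]
  rw [hreg]
  calc (l1 (rel y z) : ℝ) * (e * (((F.L : ℝ))⁻¹) ^ (2 * (K - n)))
      ≤ 3 * (F.L : ℝ) ^ (K - n) * (e * (((F.L : ℝ))⁻¹) ^ (2 * (K - n))) := mul_le_mul_of_nonneg_right hl' (mul_nonneg he hpos)
    _ = 3 * e * ((F.L : ℝ) ^ (K - n) * (((F.L : ℝ))⁻¹) ^ (2 * (K - n))) := by ring
    _ = 3 * e * (((F.L : ℝ))⁻¹) ^ (K - n) := by rw [hcollapse]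

variable {n K}

/-- **THE FIBRE IDENTITY ON COARSE BONDS**: `W, X^u ∈ (6)(e) ∩ 𝔅_k(V)` ⟹ `u(c_{y})·X̄(c)·u(c_{y′})⁻¹ = W̄(c)` for every coarse bond `c = ⟨y, ν⟩` (`X̄, W̄` the `(K−n)`-fold
(0.4)-averages; covariance ✓`iter_gaugeAct` read at the centres ✓`transfUp_eq_embIter`, and ✓`iter_eq_of_mem_fibre`). [cite: Balaban1985Averaging, (11)-(13) p.19; Balaban1985Variational, (3) p.278] -/
theorem iter_gaugeAct_centre_eq_of_mem (h : n ≤ K) {e : ℝ} {V : GaugeField (F.P n) 0 (Matrix.specialUnitaryGroup (Fin 2) ℂ)}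
    (W X : GaugeField (F.P K) 0 (Matrix.specialUnitaryGroup (Fin 2) ℂ)) (u : GaugeTransf (F.P K) 0 (Matrix.specialUnitaryGroup (Fin 2) ℂ))
    (hW : W ∈ regFibrePr F n K h e V) (hXu : GaugeField.gaugeAct u X ∈ regFibrePr F n K h e V) (c : PBond (F.P K) (K - n)) :
    u (embIter (K - n) c.src) * Averaging.iter (fun j => blockAvg (P := F.P K) (j := j) (ExpMeanLog.expMeanLogSU (n := Fin 2))) (K - n) X c *
        (u (embIter (K - n) c.tgt))⁻¹ =
      Averaging.iter (fun j => blockAvg (P := F.P K) (j := j) (ExpMeanLog.expMeanLogSU (n := Fin 2))) (K - n) W c := by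
  have hk : K - n ≤ (F.P K).m + (F.P K).K := by show K - n ≤ F.m + K; omega
  have h1 := iter_eq_of_mem_fibre F h ((mem_regFibrePr_iff F).mp hXu).1 ((mem_regFibrePr_iff F).mp hW).1
  have h2 := T4Continuum.iter_gaugeAct (fun j => blockAvg (P := F.P K) (j := j) (ExpMeanLog.expMeanLogSU (n := Fin 2))) u (K - n) hk X
  have h3 := congrFun (h2.symm.trans h1) c
  rw [← h3]
  show u (embIter (K - n) c.src) * _ * (u (embIter (K - n) c.tgt))⁻¹ = transfUp u (K - n) c.src * _ * (transfUp u (K - n) c.tgt)⁻¹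
  rw [transfUp_eq_embIter, transfUp_eq_embIter]

variable (n K)

/-- **ADJACENT CORNER GAUGES** (★p1 g14's `D(z,μ) ≤ C(e + s₀)`): `W ∈ 𝔘_k(e)` printed-regular, `L ≥ 7`, `50(500L + 7L²)e ≤ 1`; `u`, `X` with the fibre identity on coarse bonds and
the coarse twist `dist1(X̄(c)·W̄(c)⁻¹) ≤ τ`; a coarse site `c`, a fine site `x` at relative positions `ρ_κ − ε_κL^{K−n}` from every corner; then for `ε` with `ε_{κ₀} = 0`,
`ε′ = ε[κ₀ ↦ 1]` the transported centre gauges `vE_ε(x) = W(Γ_{y_ε,x})⁻¹·u(y_ε)·W(Γ_{y_ε,x})` satisfy `dist1(vE_ε(x)·vE_{ε′}(x)⁻¹) ≤ (449∕2)e + τ`.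
[cite: Balaban1985RegularSpaces, Lemma 1 (1.25)-(1.26) p.79, (1.29)-(1.30) p.81; Balaban1985Variational, (145)/(151) p.301] -/
theorem dist1_vE_adj_le_T3 (hL : 7 ≤ F.L) {e τ : ℝ} (he : 0 < e) (hε0 : 50 * (500 * (F.L : ℝ) + 7 * (F.L : ℝ) ^ 2) * e ≤ 1)
    (W X : GaugeField (F.P K) 0 (Matrix.specialUnitaryGroup (Fin 2) ℂ)) (u : GaugeTransf (F.P K) 0 (Matrix.specialUnitaryGroup (Fin 2) ℂ))
    (hW : RegPr F n K e W)
    (htwist : ∀ c' : PBond (F.P K) (K - n), u (embIter (K - n) c'.src) *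
        Averaging.iter (fun j => blockAvg (P := F.P K) (j := j) (ExpMeanLog.expMeanLogSU (n := Fin 2))) (K - n) X c' * (u (embIter (K - n) c'.tgt))⁻¹ =
      Averaging.iter (fun j => blockAvg (P := F.P K) (j := j) (ExpMeanLog.expMeanLogSU (n := Fin 2))) (K - n) W c')
    (hτ : ∀ c' : PBond (F.P K) (K - n), dist1 (Averaging.iter (fun j => blockAvg (P := F.P K) (j := j) (ExpMeanLog.expMeanLogSU (n := Fin 2))) (K - n) X c' *
        (Averaging.iter (fun j => blockAvg (P := F.P K) (j := j) (ExpMeanLog.expMeanLogSU (n := Fin 2))) (K - n) W c')⁻¹) ≤ τ)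
    (c : Site (F.P K) (K - n)) (x : Site (F.P K) 0) (ρ : Fin (F.P K).d → ℤ) (hρ : ∀ κ, 0 ≤ ρ κ ∧ ρ κ ≤ F.L ^ (K - n))
    (hform : ∀ ε : LSite (F.P K).d, (∀ ν, ε ν = 0 ∨ ε ν = 1) → ∀ κ,
      rel (embIter (K - n) (transl c ε)) x κ = ρ κ - ε κ * ((F.L ^ (K - n) : ℕ) : ℤ))
    (ε : LSite (F.P K).d) (hε : ∀ ν, ε ν = 0 ∨ ε ν = 1) (κ₀ : Fin (F.P K).d) (hκ₀ : ε κ₀ = 0) :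
    dist1 (((axialT W (embIter (K - n) (transl c ε)) x)⁻¹ * u (embIter (K - n) (transl c ε)) * axialT W (embIter (K - n) (transl c ε)) x) *
        ((axialT W (embIter (K - n) (transl c (Function.update ε κ₀ 1))) x)⁻¹ * u (embIter (K - n) (transl c (Function.update ε κ₀ 1))) *
          axialT W (embIter (K - n) (transl c (Function.update ε κ₀ 1))) x)⁻¹) ≤ (449 / 2) * e + τ := by
  have hε0' : Function.update ε κ₀ 0 = ε := by
    funext ν; by_cases hν : ν = κ₀
    · subst hν; simp [hκ₀]
    · rw [Function.update_of_ne hν]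
  have hadj : transl c (Function.update ε κ₀ 1) = (transl c ε).shift κ₀ := by rw [transl_update_one_eq_shift, hε0']
  rw [hadj]
  have hε' : ∀ ν, Function.update ε κ₀ 1 ν = 0 ∨ Function.update ε κ₀ 1 ν = 1 := update_mem01 ε hε κ₀ 1 (Or.inr rfl)
  set c₁ := transl c ε with hc₁
  have hrel : ∀ κ, rel (embIter (K - n) c₁) x κ - rel (embIter (K - n) (c₁.shift κ₀)) x κ =
      if κ₀ = κ then (((F.L ^ (K - n) : ℕ)) : ℤ) else 0 := by
    intro κ
    rw [← hadj, hform ε hε κ, hform _ hε' κ]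
    by_cases hκ : κ₀ = κ
    · subst hκ; simp [hκ₀]
    · rw [Function.update_of_ne (Ne.symm hκ), if_neg hκ]; ring
  have hl : l1 (rel (embIter (K - n) c₁) x) ≤ 3 * F.L ^ (K - n) := l1_rel_le_of_formula _ x (F.L ^ (K - n)) ρ ε hε hρ (hform ε hε)
  have hl' : l1 (rel (embIter (K - n) (c₁.shift κ₀)) x) ≤ 3 * F.L ^ (K - n) := by
    rw [← hadj]; exact l1_rel_le_of_formula _ x (F.L ^ (K - n)) ρ _ hε' hρ (hform _ hε')
  have hWc := dist1_iter_mul_inv_cornerWord_le_T3 F n K hL he hε0 W hW c₁ κ₀ x hrel hl hl'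
  have hpair := dist1_cornerPair_le (axialT W (embIter (K - n) c₁) x) (axialT W (embIter (K - n) (c₁.shift κ₀)) x)
    (u (embIter (K - n) c₁)) (u (embIter (K - n) (c₁.shift κ₀)))
    (Averaging.iter (fun j => blockAvg (P := F.P K) (j := j) (ExpMeanLog.expMeanLogSU (n := Fin 2))) (K - n) X ⟨c₁, κ₀⟩)
    (Averaging.iter (fun j => blockAvg (P := F.P K) (j := j) (ExpMeanLog.expMeanLogSU (n := Fin 2))) (K - n) W ⟨c₁, κ₀⟩) (htwist ⟨c₁, κ₀⟩)
  have hτc := hτ ⟨c₁, κ₀⟩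
  linarith

/-- **ANY TWO CORNERS OF THE CELL** (d = 3, chain of three adjacent pairs): `dist1(vE_ε(x)·vE_{ε′}(x)⁻¹) ≤ 3·((449∕2)e + τ)`.
[cite: Balaban1985RegularSpaces, Lemma 1 (1.25)-(1.26) p.79] -/
theorem dist1_vE_pair_le_T3 (hL : 7 ≤ F.L) {e τ : ℝ} (he : 0 < e) (hτ0 : 0 ≤ τ) (hε0 : 50 * (500 * (F.L : ℝ) + 7 * (F.L : ℝ) ^ 2) * e ≤ 1)
    (W X : GaugeField (F.P K) 0 (Matrix.specialUnitaryGroup (Fin 2) ℂ)) (u : GaugeTransf (F.P K) 0 (Matrix.specialUnitaryGroup (Fin 2) ℂ))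
    (hW : RegPr F n K e W)
    (htwist : ∀ c' : PBond (F.P K) (K - n), u (embIter (K - n) c'.src) *
        Averaging.iter (fun j => blockAvg (P := F.P K) (j := j) (ExpMeanLog.expMeanLogSU (n := Fin 2))) (K - n) X c' * (u (embIter (K - n) c'.tgt))⁻¹ =
      Averaging.iter (fun j => blockAvg (P := F.P K) (j := j) (ExpMeanLog.expMeanLogSU (n := Fin 2))) (K - n) W c')
    (hτ : ∀ c' : PBond (F.P K) (K - n), dist1 (Averaging.iter (fun j => blockAvg (P := F.P K) (j := j) (ExpMeanLog.expMeanLogSU (n := Fin 2))) (K - n) X c' *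
        (Averaging.iter (fun j => blockAvg (P := F.P K) (j := j) (ExpMeanLog.expMeanLogSU (n := Fin 2))) (K - n) W c')⁻¹) ≤ τ)
    (c : Site (F.P K) (K - n)) (x : Site (F.P K) 0) (ρ : Fin (F.P K).d → ℤ) (hρ : ∀ κ, 0 ≤ ρ κ ∧ ρ κ ≤ F.L ^ (K - n))
    (hform : ∀ ε : LSite (F.P K).d, (∀ ν, ε ν = 0 ∨ ε ν = 1) → ∀ κ,
      rel (embIter (K - n) (transl c ε)) x κ = ρ κ - ε κ * ((F.L ^ (K - n) : ℕ) : ℤ))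
    (ε ε' : LSite (F.P K).d) (hε : ∀ ν, ε ν = 0 ∨ ε ν = 1) (hε' : ∀ ν, ε' ν = 0 ∨ ε' ν = 1) :
    dist1 (((axialT W (embIter (K - n) (transl c ε)) x)⁻¹ * u (embIter (K - n) (transl c ε)) * axialT W (embIter (K - n) (transl c ε)) x) *
        ((axialT W (embIter (K - n) (transl c ε')) x)⁻¹ * u (embIter (K - n) (transl c ε')) * axialT W (embIter (K - n) (transl c ε')) x)⁻¹) ≤
      3 * ((449 / 2) * e + τ) := by
  have hd : (F.P K).d = 3 := T3Family.P_d F K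
  obtain ⟨κ0, κ1, κ2, hκ⟩ : ∃ κ0 κ1 κ2 : Fin (F.P K).d, ∀ ν : Fin (F.P K).d, ν = κ0 ∨ ν = κ1 ∨ ν = κ2 := by
    refine ⟨⟨0, by omega⟩, ⟨1, by omega⟩, ⟨2, by omega⟩, fun ν => ?_⟩
    rcases ν with ⟨v, hv⟩
    have : v = 0 ∨ v = 1 ∨ v = 2 := by omega
    rcases this with h | h | h
    · left; exact Fin.ext h
    · right; left; exact Fin.ext h
    · right; right; exact Fin.ext h
  have ha : 0 ≤ (449 / 2) * e + τ := by positivity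
  exact dist1_chain3_le κ0 κ1 κ2 hκ
    (fun δ => (axialT W (embIter (K - n) (transl c δ)) x)⁻¹ * u (embIter (K - n) (transl c δ)) * axialT W (embIter (K - n) (transl c δ)) x) ha
    (fun δ hδ κ hκ0 => dist1_vE_adj_le_T3 F n K hL he hε0 W X u hW htwist hτ c x ρ hρ hform δ hδ κ hκ0) ε ε' hε hε'

/-- **TRANSPORT OF A CORNER GAUGE ALONG A BOND OF THE CELL** (★p1 g14's `ρ ≤ s + 2‖P_b − 1‖`, NO smallness of `u`): `W ∈ 𝔘_k(e)` printed-regular, at least three blocks per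
direction, `dist1(X_b·W_b⁻¹) ≤ s` on every bond; then for the cell of `z`, any corner `ε` and `b = ⟨z, μ⟩`:
`dist1(vE_ε(z)·X_b·vE_ε(z+e_μ)⁻¹·W_b⁻¹) ≤ s + 6e·L^{−(K−n)}`. [cite: Balaban1985RegularSpaces, Lemma 1 (1.25) p.79; Balaban1985Averaging, pp.24-25] -/
theorem dist1_vE_transport_le_T3 (hk : K - n ≤ (F.P K).m + (F.P K).K) (hN : 3 ≤ (F.P K).sitesPerDir (K - n)) {off : ℕ}
    (hoff : ∀ (y : Site (F.P K) (K - n)) (μ : Fin (F.P K).d), ((embIter (K - n) y) μ).val = (y μ).val * (F.P K).L ^ (K - n) + off)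
    {e s : ℝ} (he : 0 ≤ e) (W X : GaugeField (F.P K) 0 (Matrix.specialUnitaryGroup (Fin 2) ℂ))
    (u : GaugeTransf (F.P K) 0 (Matrix.specialUnitaryGroup (Fin 2) ℂ)) (hW : RegPr F n K e W)
    (hs : ∀ b : PBond (F.P K) 0, dist1 (X b * (W b)⁻¹) ≤ s)
    (z : Site (F.P K) 0) (ε : LSite (F.P K).d) (hε : ∀ ν, ε ν = 0 ∨ ε ν = 1) (μ : Fin (F.P K).d) :
    dist1 (((axialT W (embIter (K - n) (transl (iterBlockOf (K - n) (transl z (fun _ => -(off : ℤ)))) ε)) z)⁻¹ *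
            u (embIter (K - n) (transl (iterBlockOf (K - n) (transl z (fun _ => -(off : ℤ)))) ε)) *
            axialT W (embIter (K - n) (transl (iterBlockOf (K - n) (transl z (fun _ => -(off : ℤ)))) ε)) z) * X ⟨z, μ⟩ *
        ((axialT W (embIter (K - n) (transl (iterBlockOf (K - n) (transl z (fun _ => -(off : ℤ)))) ε)) (z.shift μ))⁻¹ *
            u (embIter (K - n) (transl (iterBlockOf (K - n) (transl z (fun _ => -(off : ℤ)))) ε)) *
            axialT W (embIter (K - n) (transl (iterBlockOf (K - n) (transl z (fun _ => -(off : ℤ)))) ε)) (z.shift μ))⁻¹ * (W ⟨z, μ⟩)⁻¹) ≤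
      s + 6 * e * (((F.L : ℝ))⁻¹) ^ (K - n) := by
  have h1 := dist1_cornerTransport_le
    (axialT W (embIter (K - n) (transl (iterBlockOf (K - n) (transl z (fun _ => -(off : ℤ)))) ε)) z)
    (axialT W (embIter (K - n) (transl (iterBlockOf (K - n) (transl z (fun _ => -(off : ℤ)))) ε)) (z.shift μ))
    (u (embIter (K - n) (transl (iterBlockOf (K - n) (transl z (fun _ => -(off : ℤ)))) ε))) (X ⟨z, μ⟩) (W ⟨z, μ⟩)
  have h2 := dist1_combLoop_corner_le_T3 F n K hk hN hoff he W hW z ε hε μ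
  have h3 := hs ⟨z, μ⟩
  linarith

end T3

end Summit.QuantumFields.YangMills.Theorems.Prop7UntwistCornerData

end
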